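import Literature.Barriers.CriticalPhenomena.PlaquetteWalkHoleRootHoleColumnPhases
import Literature.Barriers.CriticalPhenomena.PlaquetteWalkAngleLimitColumnCoherence
import HarnessLib

/-!
# Barrier catalogue (SAWScalingLimit): in the HOLE COLUMN BELOW the hole the straight level-`7` member winds `−7` quarter turns, has turn classes forced by its two
kisses, PHASE INDEX `0`, `5`, `3` or `0`, and LIMIT WEIGHT `(√2)⁷ · ζ^{4k}`, `k ∈ {2, 7, 5}` («HOLE COLUMN BELOW: CLASSES, PHASES AND LIMIT WEIGHT»)

`Z → ∞` limit model of the printed Yang–Baxter weights [GlazmanManolescu2019, §1, eq. (1)]; the «RECTANGLE COEFFICIENT» line (b-engine-1 g29): the row-mirror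
[GlazmanManolescu2019, §4.2] of `PlaquetteWalkHoleRootHoleColumnPhases` (and of its limit-weight corollary), the other half of the lane's HOLE-COLUMN census law
(FINDING-YB-HOLE-COLUMN-FOUR-PHASE §2: below the hole every cost-`7` wound member has census phase `k ∈ {0, 2, 5, 7}` — antipode-free).

* ★ `arcSides_mirrorArc`, `classCount_map_mirrorRow`, ★★ `vlCount_map_mirrorRow` / `vrCount_map_mirrorRow` / `hlCount_map_mirrorRow` / `hrCount_map_mirrorRow`,
  `phaseIndex_map_mirrorRow` — under the reflection in a row the four turn classes are exchanged `VL ↔ VR`, `HL ↔ HR` (left ↔ right, the entry orientation kept),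
  so `phaseIndex` of the reflected list is `3(n_{VR} + n_{w₂}) + 2n_{w₁} (mod 8)` of the list;
* ★★★ `ΩG.classes_of_cost_seven_straight_holeColumn_below` — for a wound class-`B2a` walk of limit cost `7` from the hole root with a slanted end and a straight
  first arc at a hole-column rhombus `r` strictly BELOW the hole, some arc below the row of `r`: with `a = [p₁ kissed]`, `b = [hook corner kissed]` (`a, b ≤ 1`),
  `quarterTurnsL = −7` and `(n_{w₁}, n_{w₂}, n_{VR}, n_{HR}, n_{VL}, n_{HL}) = (b, a, 3 + b, 4 + a, a, b)`;
* ★★★ `ΩG.phaseIndex_of_cost_seven_straight_holeColumn_below` — **`phaseIndex = (5a + 3b) mod 8`**: `0, 5, 3, 0`; `ΩG.phaseIndex_mem_…_below`: `∈ {0, 3, 5}`;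
* ★★★ `ΩG.limitWeight_of_cost_seven_straight_holeColumn_below` — the end is `S` (slot sign `−1 = ζ¹⁶`), `n_{u₁} + n_{u₂} = 7`, and
  **`limitWeight = (√2)⁷ · ζ^{4((2 + 5a + 3b) mod 8)}`**: `ζ⁸, ζ²⁸, ζ²⁰, ζ⁸` — census phases `k = 2, 7, 5, 2`; `ΩG.limitWeight_mem_…_below`:
  `limitWeight ∈ {(√2)⁷ζ⁸, (√2)⁷ζ²⁸, (√2)⁷ζ²⁰}` ⊂ the antipode-free set `{0, 2, 5, 7}` of `PlaquetteWalkAngleLimitAntipode.sum_phases_below_eq_zero_iff` (kit j298353: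
  1 123 hole-column cells below the hole; these members occur with `k = 2, 7, 5, 2` at 605, 614, 607, 616 cells; the fourth phase `k = 0` is class `B2b` only).

[GlazmanManolescu2019 §1 eq. (1), Lemma 2.1, Remark 2.2, §4.2; Glazman2015WeightedSAW Lemma 3.1 (proof); the `Z → ∞` bookkeeping is lane plumbing.]
-/

noncomputable section

namespace Literature.Barriers.CriticalPhenomena.PlaquetteWalk

open Literature.Probability.RandomPlanarGeometry.SAW.YangBaxter

/-! ## The four turn classes under the row reflection -/

/-- The entry/exit sides of the reflected arc are the reflected sides. [cite: GlazmanManolescu2019, §4.2 (lattice symmetries); §1, Fig. 1] -/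
theorem arcSides_mirrorArc (c : ℤ) (p : MidEdge × MidEdge) :
    arcSides (mirrorArc c p) = (arcSides p).map (fun st => (mirrorSide st.1, mirrorSide st.2)) := by
  unfold arcSides
  rw [arcFace_mirrorArc]
  cases arcFace p with
  | none => rfl
  | some f =>
    simp only [Option.map_some, Option.bind_some, mirrorArc, Prod.map_fst, Prod.map_snd, sideOf_mirrorRow]
    cases f.sideOf p.1 with
    | none => simp
    | some s =>
      cases f.sideOf p.2 with
      | none => simp
      | some t => simp

/-- A turn class of the reflected list is the reflected class of the list. [cite: GlazmanManolescu2019, §4.2 (lattice symmetries); §1, Fig. 1 (lane plumbing)] -/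
theorem classCount_map_mirrorRow (cl : Side × Side → Bool) (c : ℤ) (l : List MidEdge) :
    classCount cl (l.map (mirrorRow c)) = classCount (fun st => cl (mirrorSide st.1, mirrorSide st.2)) l := by
  unfold classCount
  rw [arcsOf_map_mirrorRow, List.countP_map]
  congr 1
  funext p
  simp only [Function.comp_apply, arcSides_mirrorArc]
  cases arcSides p <;> rfl

/-- ★★ **`n_{VL}` of the reflected list is `n_{VR}`** (a left turn entered vertically reflects to a right turn entered vertically).
[cite: GlazmanManolescu2019, §4.2 (lattice symmetries); §1, Fig. 1] -/
theorem vlCount_map_mirrorRow (c : ℤ) (l : List MidEdge) : vlCount (l.map (mirrorRow c)) = vrCount l := by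
  unfold vlCount vrCount
  rw [classCount_map_mirrorRow]
  congr 1
  funext st
  obtain ⟨s, t⟩ := st
  cases s <;> cases t <;> rfl

/-- ★★ **`n_{VR}` of the reflected list is `n_{VL}`.** [cite: GlazmanManolescu2019, §4.2 (lattice symmetries); §1, Fig. 1] -/
theorem vrCount_map_mirrorRow (c : ℤ) (l : List MidEdge) : vrCount (l.map (mirrorRow c)) = vlCount l := by
  unfold vlCount vrCount
  rw [classCount_map_mirrorRow]
  congr 1
  funext st
  obtain ⟨s, t⟩ := st
  cases s <;> cases t <;> rfl

/-- ★★ **`n_{HL}` of the reflected list is `n_{HR}`.** [cite: GlazmanManolescu2019, §4.2 (lattice symmetries); §1, Fig. 1] -/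
theorem hlCount_map_mirrorRow (c : ℤ) (l : List MidEdge) : hlCount (l.map (mirrorRow c)) = hrCount l := by
  unfold hlCount hrCount
  rw [classCount_map_mirrorRow]
  congr 1
  funext st
  obtain ⟨s, t⟩ := st
  cases s <;> cases t <;> rfl

/-- ★★ **`n_{HR}` of the reflected list is `n_{HL}`.** [cite: GlazmanManolescu2019, §4.2 (lattice symmetries); §1, Fig. 1] -/
theorem hrCount_map_mirrorRow (c : ℤ) (l : List MidEdge) : hrCount (l.map (mirrorRow c)) = hlCount l := by
  unfold hlCount hrCount
  rw [classCount_map_mirrorRow]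
  congr 1
  funext st
  obtain ⟨s, t⟩ := st
  cases s <;> cases t <;> rfl

/-- ★★ **The phase index of the reflected list**: `X(mirror l) = (3(n_{VR} + n_{w₂}) + 2n_{w₁}) mod 8` in terms of the list (`VL ↔ VR`, `w₁ ↔ w₂`).
[cite: GlazmanManolescu2019, §4.2 (lattice symmetries); §1, Fig. 1 and eq. (1)] -/
theorem phaseIndex_map_mirrorRow (c : ℤ) (l : List MidEdge) :
    phaseIndex (l.map (mirrorRow c)) = (3 * (vrCount l + cfgCount l [.coCorner, .coCorner]) + 2 * cfgCount l [.corner, .corner]) % 8 := by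
  unfold phaseIndex
  rw [vlCount_map_mirrorRow, cfgCount_map_mirrorRow, cfgCount_map_mirrorRow]
  rfl

end Literature.Barriers.CriticalPhenomena.PlaquetteWalk

namespace Literature.Probability.RandomPlanarGeometry.SAW.YangBaxter

open Real
open Literature.Barriers.CriticalPhenomena.PlaquetteWalk

namespace ΩG

variable {D : Set Face} {w r : Face} {ω : ΩG D (w.side .W) r}

/-- `ζ^n = ζ^{n mod 32}` (`ζ³² = 1`). [cite: GlazmanManolescu2019, §1, eq. (1) (lane plumbing)] -/
private theorem zeta32_pow_mod32 (n : ℕ) : zeta32 ^ n = zeta32 ^ (n % 32) := by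
  conv_lhs => rw [← Nat.mod_add_div n 32, pow_add, pow_mul, zeta32_pow_thirtyTwo, one_pow, mul_one]

/-- A plaquette visited twice on the row `2w.2 − y` by the reflected walk is a plaquette visited twice on the row `y` by the walk.
[cite: GlazmanManolescu2019, §4.2 (lattice symmetries)] -/
private theorem kiss_mirrorAt_iff {y y' : ℤ} (hy : y' = 2 * w.2 - y) :
    (∃ l l' : ℕ, l < ω.mirrorAt.2.arcs.length ∧ l' < ω.mirrorAt.2.arcs.length ∧ l ≠ l' ∧ ω.mirrorAt.2.fc l = ω.mirrorAt.2.fc l' ∧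
        (ω.mirrorAt.2.fc l).2 = y') ↔
      (∃ l l' : ℕ, l < ω.2.arcs.length ∧ l' < ω.2.arcs.length ∧ l ≠ l' ∧ ω.2.fc l = ω.2.fc l' ∧ (ω.2.fc l).2 = y) := by
  have hlen : ω.mirrorAt.2.arcs.length = ω.2.arcs.length := YBWalk.length_arcs_eq_of_mids_mirror ω.mirrorAt_mids
  have hfcm : ∀ i < ω.2.arcs.length, ω.mirrorAt.2.fc i = mirrorRowFace w.2 (ω.2.fc i) := fun i hi =>
    YBWalk.fc_eq_of_mids_mirror ω.mirrorAt_mids hi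
  constructor
  · rintro ⟨l, l', hl, hl', hne, hfc, hyl⟩
    rw [hlen] at hl hl'
    rw [hfcm l hl, hfcm l' hl'] at hfc
    rw [hfcm l hl] at hyl
    refine ⟨l, l', hl, hl', hne, ?_, ?_⟩
    · have := congrArg (mirrorRowFace w.2) hfc
      rwa [mirrorRowFace_mirrorRowFace, mirrorRowFace_mirrorRowFace] at this
    · simp only [mirrorRowFace] at hyl; omega
  · rintro ⟨l, l', hl, hl', hne, hfc, hyl⟩
    refine ⟨l, l', by rw [hlen]; exact hl, by rw [hlen]; exact hl', hne, ?_, ?_⟩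
    · rw [hfcm l hl, hfcm l' hl', hfc]
    · rw [hfcm l hl]; simp only [mirrorRowFace]; omega

/-- ★★★ **HOLE COLUMN BELOW THE HOLE: QUARTER TURNS AND TURN CLASSES OF THE LEVEL-`7` MEMBER.** Let `ω` be a wound class-`B2a` walk of limit cost `7` from the
hole root `w.side W` (hole `(w.1 − 1, w.2)` absent) with a slanted end and a STRAIGHT first arc at a rhombus `r` of the hole column (`r.1 = w.1 − 1`) strictly below
the hole, some arc of `ω` lying strictly below the row of `r`. With `a = 1` iff a plaquette of the root row is visited twice (the first turning plaquette `p₁`, a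
`w₂` kiss: arcs `W → S`, `N → E`) and `b = 1` iff a plaquette of the row of `r` is visited twice (the hook corner, a `w₁` kiss: arcs `N → W`, `E → S`), `a, b ≤ 1`:
`quarterTurnsL = −7` and `n_{w₁} = b`, `n_{w₂} = a`, `n_{VR} = 3 + b`, `n_{HR} = 4 + a`, `n_{VL} = a`, `n_{HL} = b` — the row-mirror [GlazmanManolescu2019, §4.2] of
`classes_of_cost_seven_straight_holeColumn_above`. [cite: GlazmanManolescu2019, §1, Fig. 1 and eq. (1); Lemma 2.1; Remark 2.2; §4.2 (lattice symmetries)]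
[cite: Glazman2015WeightedSAW, Lemma 3.1 (proof, pp. 6–7)] [cite: Hopf1935, Nr. 2 (Umlaufsatz, p. 53)] -/
theorem classes_of_cost_seven_straight_holeColumn_below (hh : holeFaceW w ∉ D) (hr : RootedFace D (w.side .W) r) (h : ω.IsB2a)
    (hA : ω.AJ hr h (toC (midPt (w.side .W))) ≠ 0) (hc : cost (slotOfSide ω.1) ω.2.mids = 7) (hz : ω.1 = .N ∨ ω.1 = .S)
    (hstr8 : arcKind (ω.2.sIn ω.2.firstHitG) (ω.2.sOut ω.2.firstHitG) = .straight) (hcol : r.1 = w.1 - 1) (hbelow : r.2 < w.2)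
    (hdown : ∃ j < ω.2.arcs.length, (ω.2.fc j).2 < r.2) :
    ∃ a b : ℕ, a ≤ 1 ∧ b ≤ 1 ∧
      ((a = 1 ↔ ∃ l l' : ℕ, l < ω.2.arcs.length ∧ l' < ω.2.arcs.length ∧ l ≠ l' ∧ ω.2.fc l = ω.2.fc l' ∧ (ω.2.fc l).2 = w.2) ∧
        (b = 1 ↔ ∃ l l' : ℕ, l < ω.2.arcs.length ∧ l' < ω.2.arcs.length ∧ l ≠ l' ∧ ω.2.fc l = ω.2.fc l' ∧ (ω.2.fc l).2 = r.2)) ∧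
      quarterTurnsL ω.2.mids = -7 ∧
      cfgCount ω.2.mids [.corner, .corner] = b ∧ cfgCount ω.2.mids [.coCorner, .coCorner] = a ∧
      vrCount ω.2.mids = 3 + b ∧ hrCount ω.2.mids = 4 + a ∧ vlCount ω.2.mids = a ∧ hlCount ω.2.mids = b := by
  classical
  set n := ω.2.arcs.length with hn
  have hF := ω.fh_lt h
  -- reflect in the root row (as in `sevenTurns_of_cost_seven_straight_holeColumn_below`)
  have hh' : holeFaceW w ∉ rowMirrorDom w D := by
    rw [mem_rowMirrorDom]
    have e : mirrorRowFace w.2 (holeFaceW w) = holeFaceW w := by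
      simp only [mirrorRowFace, holeFaceW]; exact Prod.ext rfl (by simp only; ring)
    rw [e]; exact hh
  have hr' := rootedFace_rowMirrorDom_mirrorRowFace (w := w) hr
  have h' := isB2a_mirrorAt hr h
  have hA' := AJ_mirrorAt_ne_zero hr h hA
  have hc' : cost (slotOfSide ω.mirrorAt.1) ω.mirrorAt.2.mids = 7 := by
    show cost (slotOfSide (mirrorSide ω.1)) (ω.2.mids.map (mirrorRow w.2)) = 7
    rw [cost_map_mirrorRow]; exact hc
  have hz' : ω.mirrorAt.1 = .N ∨ ω.mirrorAt.1 = .S := by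
    show mirrorSide ω.1 = .N ∨ mirrorSide ω.1 = .S
    rcases hz with e | e <;> rw [e]
    · exact Or.inr rfl
    · exact Or.inl rfl
  have hlen : ω.mirrorAt.2.arcs.length = n := YBWalk.length_arcs_eq_of_mids_mirror ω.mirrorAt_mids
  have hfcm : ∀ i < n, ω.mirrorAt.2.fc i = mirrorRowFace w.2 (ω.2.fc i) := fun i hi => YBWalk.fc_eq_of_mids_mirror ω.mirrorAt_mids hi
  have hFm : ω.mirrorAt.2.firstHitG = ω.2.firstHitG := YBWalk.firstHitG_eq_of_mids_mirror ω.mirrorAt_mids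
  have hstr8' : arcKind (ω.mirrorAt.2.sIn ω.mirrorAt.2.firstHitG) (ω.mirrorAt.2.sOut ω.mirrorAt.2.firstHitG) = .straight := by
    obtain ⟨e1, e2⟩ := YBWalk.sIn_sOut_eq_of_mids_mirror ω.mirrorAt_mids (i := ω.2.firstHitG) hF
    rw [hFm, e1, e2, arcKind_mirrorSide, hstr8]; rfl
  have hcol' : (mirrorRowFace w.2 r).1 = w.1 - 1 := by simp only [mirrorRowFace]; exact hcol
  have habove' : w.2 < (mirrorRowFace w.2 r).2 := by simp only [mirrorRowFace]; omega
  have hup' : ∃ j < ω.mirrorAt.2.arcs.length, (mirrorRowFace w.2 r).2 < (ω.mirrorAt.2.fc j).2 := by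
    obtain ⟨j, hj, hjr⟩ := hdown
    refine ⟨j, by rw [hlen]; exact hj, ?_⟩
    rw [hfcm j hj]; simp only [mirrorRowFace]; omega
  have hq' := quarterTurnsL_of_cost_seven_straight_holeColumn_above (ω := ω.mirrorAt) hh' hr' h' hA' hc' hz' hstr8' hcol' habove' hup'
  obtain ⟨a, b, ha, hb, ⟨hka, hkb⟩, hw1, hw2, hvr, hhr, hvl, hhl⟩ :=
    classes_of_cost_seven_straight_holeColumn_above (ω := ω.mirrorAt) hh' hr' h' hA' hc' hz' hstr8' hcol' habove' hup'
  -- transport back through `ω.mirrorAt.2.mids = ω.2.mids.map (mirrorRow w.2)`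
  have hm : ω.mirrorAt.2.mids = ω.2.mids.map (mirrorRow w.2) := ω.mirrorAt_mids
  rw [hm] at hq' hw1 hw2 hvr hhr hvl hhl
  rw [quarterTurnsL_map_mirrorRow] at hq'
  rw [cfgCount_map_mirrorRow] at hw1 hw2
  rw [vrCount_map_mirrorRow] at hvr
  rw [hrCount_map_mirrorRow] at hhr
  rw [vlCount_map_mirrorRow] at hvl
  rw [hlCount_map_mirrorRow] at hhl
  have hr2 : (mirrorRowFace w.2 r).2 = 2 * w.2 - r.2 := rfl
  rw [hr2] at hkb
  refine ⟨a, b, ha, hb, ⟨hka.trans (kiss_mirrorAt_iff (by ring)), hkb.trans (kiss_mirrorAt_iff rfl)⟩, by omega, hw2, hw1, hvl, hhl, hvr, hhr⟩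

/-- ★★★ **HOLE COLUMN BELOW THE HOLE: THE PHASE INDEX.** In the setting of `classes_of_cost_seven_straight_holeColumn_below`, with the kiss indicators `a` (root
row) and `b` (row of `r`): **`phaseIndex = (5a + 3b) mod 8`** — `0` (no kiss), `5` (kiss at `p₁`), `3` (hook kiss), `0` (both); census units `k = X + 2 ∈ {2, 7, 5, 2}`.
[cite: GlazmanManolescu2019, §1, Fig. 1 and eq. (1); Lemma 2.1; Remark 2.2; §4.2 (lattice symmetries)] [cite: Glazman2015WeightedSAW, Lemma 3.1 (proof, pp. 6–7)] -/
theorem phaseIndex_of_cost_seven_straight_holeColumn_below (hh : holeFaceW w ∉ D) (hr : RootedFace D (w.side .W) r) (h : ω.IsB2a)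
    (hA : ω.AJ hr h (toC (midPt (w.side .W))) ≠ 0) (hc : cost (slotOfSide ω.1) ω.2.mids = 7) (hz : ω.1 = .N ∨ ω.1 = .S)
    (hstr8 : arcKind (ω.2.sIn ω.2.firstHitG) (ω.2.sOut ω.2.firstHitG) = .straight) (hcol : r.1 = w.1 - 1) (hbelow : r.2 < w.2)
    (hdown : ∃ j < ω.2.arcs.length, (ω.2.fc j).2 < r.2) :
    ∃ a b : ℕ, a ≤ 1 ∧ b ≤ 1 ∧
      ((a = 1 ↔ ∃ l l' : ℕ, l < ω.2.arcs.length ∧ l' < ω.2.arcs.length ∧ l ≠ l' ∧ ω.2.fc l = ω.2.fc l' ∧ (ω.2.fc l).2 = w.2) ∧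
        (b = 1 ↔ ∃ l l' : ℕ, l < ω.2.arcs.length ∧ l' < ω.2.arcs.length ∧ l ≠ l' ∧ ω.2.fc l = ω.2.fc l' ∧ (ω.2.fc l).2 = r.2)) ∧
      phaseIndex ω.2.mids = (5 * a + 3 * b) % 8 := by
  obtain ⟨a, b, ha, hb, hab, -, hw1, hw2, -, -, hvl, -⟩ :=
    classes_of_cost_seven_straight_holeColumn_below hh hr h hA hc hz hstr8 hcol hbelow hdown
  refine ⟨a, b, ha, hb, hab, ?_⟩
  unfold phaseIndex
  rw [hvl, hw1, hw2]
  omega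

/-- ★★★ **HOLE COLUMN BELOW THE HOLE: THE LIMIT WEIGHT OF THE LEVEL-`7` MEMBER.** In the same setting the end is `S`, `n_{u₁} + n_{u₂} = 7`, and with the kiss
indicators `a, b`: **`limitWeight = (√2)⁷ · ζ^{4((2 + 5a + 3b) mod 8)}`** (`ζ = e^{iπ/16}`; the slot sign `−1 = ζ¹⁶` and `(ζ⁴ + ζ¹²)⁷ = (√2)⁷ζ²⁴` shift the phase
index by `2`): `ζ⁸, ζ²⁸, ζ²⁰, ζ⁸` for `(a, b) = (0,0), (1,0), (0,1), (1,1)` — census phases `k = 2, 7, 5, 2`. [cite: GlazmanManolescu2019, §1, Fig. 1 and eq. (1);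
Lemma 2.1, eq. (CR); §2.1, eq. (2.1); §4.2 (lattice symmetries)] [cite: Glazman2015WeightedSAW, Lemma 3.1 (proof, pp. 6–7)] -/
theorem limitWeight_of_cost_seven_straight_holeColumn_below (hh : holeFaceW w ∉ D) (hr : RootedFace D (w.side .W) r) (h : ω.IsB2a)
    (hA : ω.AJ hr h (toC (midPt (w.side .W))) ≠ 0) (hc : cost (slotOfSide ω.1) ω.2.mids = 7) (hz : ω.1 = .N ∨ ω.1 = .S)
    (hstr8 : arcKind (ω.2.sIn ω.2.firstHitG) (ω.2.sOut ω.2.firstHitG) = .straight) (hcol : r.1 = w.1 - 1) (hbelow : r.2 < w.2)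
    (hdown : ∃ j < ω.2.arcs.length, (ω.2.fc j).2 < r.2) :
    ω.1 = .S ∧ cfgCount ω.2.mids [.corner] + cfgCount ω.2.mids [.coCorner] = 7 ∧
    ∃ a b : ℕ, a ≤ 1 ∧ b ≤ 1 ∧
      ((a = 1 ↔ ∃ l l' : ℕ, l < ω.2.arcs.length ∧ l' < ω.2.arcs.length ∧ l ≠ l' ∧ ω.2.fc l = ω.2.fc l' ∧ (ω.2.fc l).2 = w.2) ∧
        (b = 1 ↔ ∃ l l' : ℕ, l < ω.2.arcs.length ∧ l' < ω.2.arcs.length ∧ l ≠ l' ∧ ω.2.fc l = ω.2.fc l' ∧ (ω.2.fc l).2 = r.2)) ∧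
      phaseIndex ω.2.mids = (5 * a + 3 * b) % 8 ∧
      limitWeight (slotOfSide ω.1) ω.2.mids = ((Real.sqrt 2 : ℝ) : ℂ) ^ 7 * zeta32 ^ (4 * ((2 + 5 * a + 3 * b) % 8)) := by
  have hS : ω.1 = .S := (descent_of_cost_seven_straight_holeColumn_below hh hr h hA hc hz hstr8 hcol hbelow hdown).1
  have hdeg : slotDeg (slotOfSide ω.1) = 1 := by rw [hS]; rfl
  have hm : cfgCount ω.2.mids [.corner] + cfgCount ω.2.mids [.coCorner] = 7 := by
    have hc' := hc
    unfold cost at hc'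
    rw [hdeg] at hc'
    omega
  obtain ⟨a, b, ha, hb, hab, hX⟩ := phaseIndex_of_cost_seven_straight_holeColumn_below hh hr h hA hc hz hstr8 hcol hbelow hdown
  refine ⟨hS, hm, a, b, ha, hb, hab, hX, ?_⟩
  have hvert : vertB (w.side .W) = true := by rw [vertB_side_eq_slotDeg]; rfl
  have hlw := limitWeight_eq_phaseIndex ω.2 hvert (slotOfSide ω.1) (vertB_side_eq_slotDeg r ω.1)
  rw [hm, hX] at hlw
  rw [hlw]
  have hsign : slotSign (slotOfSide ω.1) = -1 := by rw [hS]; rfl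
  rw [hsign, zeta32_four_add_twelve_eq_sqrt, mul_pow, ← pow_mul, show (-1 : ℂ) = zeta32 ^ 16 from zeta32_pow_sixteen.symm,
    show zeta32 ^ 16 * (((Real.sqrt 2 : ℝ) : ℂ) ^ 7 * zeta32 ^ (8 * 7)) * zeta32 ^ (4 * ((5 * a + 3 * b) % 8)) =
      ((Real.sqrt 2 : ℝ) : ℂ) ^ 7 * zeta32 ^ (16 + 8 * 7 + 4 * ((5 * a + 3 * b) % 8)) by ring]
  congr 1
  rw [zeta32_pow_mod32]
  interval_cases a <;> interval_cases b <;> norm_num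

/-- ★★★ **HOLE COLUMN BELOW THE HOLE: THREE PHASES, NO ANTIPODAL PAIR.** In the same setting `limitWeight ∈ {(√2)⁷ζ⁸, (√2)⁷ζ²⁸, (√2)⁷ζ²⁰}` — census phases
`k ∈ {2, 7, 5}`, inside the antipode-free set `{0, 2, 5, 7}` of `sum_phases_below_eq_zero_iff`: these members never cancel among themselves in the level-`7`
wound sum. [cite: GlazmanManolescu2019, §1, Fig. 1 and eq. (1); Lemma 2.1, eq. (CR); §2.1, eq. (2.1); §4.2] [cite: Glazman2015WeightedSAW, Lemma 3.1 (proof, pp. 6–7)] -/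
theorem limitWeight_mem_of_cost_seven_straight_holeColumn_below (hh : holeFaceW w ∉ D) (hr : RootedFace D (w.side .W) r) (h : ω.IsB2a)
    (hA : ω.AJ hr h (toC (midPt (w.side .W))) ≠ 0) (hc : cost (slotOfSide ω.1) ω.2.mids = 7) (hz : ω.1 = .N ∨ ω.1 = .S)
    (hstr8 : arcKind (ω.2.sIn ω.2.firstHitG) (ω.2.sOut ω.2.firstHitG) = .straight) (hcol : r.1 = w.1 - 1) (hbelow : r.2 < w.2)
    (hdown : ∃ j < ω.2.arcs.length, (ω.2.fc j).2 < r.2) :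
    limitWeight (slotOfSide ω.1) ω.2.mids = ((Real.sqrt 2 : ℝ) : ℂ) ^ 7 * zeta32 ^ 8 ∨
      limitWeight (slotOfSide ω.1) ω.2.mids = ((Real.sqrt 2 : ℝ) : ℂ) ^ 7 * zeta32 ^ 28 ∨
      limitWeight (slotOfSide ω.1) ω.2.mids = ((Real.sqrt 2 : ℝ) : ℂ) ^ 7 * zeta32 ^ 20 := by
  obtain ⟨-, -, a, b, ha, hb, -, -, hlw⟩ := limitWeight_of_cost_seven_straight_holeColumn_below hh hr h hA hc hz hstr8 hcol hbelow hdown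
  rw [hlw]
  interval_cases a <;> interval_cases b <;> norm_num

/-- ★★★ **HOLE COLUMN BELOW THE HOLE: THE PHASE INDEX IS `0`, `3` OR `5`** (no two antipodal). [cite: GlazmanManolescu2019, §1, Fig. 1 and eq. (1); Lemma 2.1,
eq. (CR); §2.1, eq. (2.1); §4.2] [cite: Glazman2015WeightedSAW, Lemma 3.1 (proof, pp. 6–7)] -/
theorem phaseIndex_mem_of_cost_seven_straight_holeColumn_below (hh : holeFaceW w ∉ D) (hr : RootedFace D (w.side .W) r) (h : ω.IsB2a)
    (hA : ω.AJ hr h (toC (midPt (w.side .W))) ≠ 0) (hc : cost (slotOfSide ω.1) ω.2.mids = 7) (hz : ω.1 = .N ∨ ω.1 = .S)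
    (hstr8 : arcKind (ω.2.sIn ω.2.firstHitG) (ω.2.sOut ω.2.firstHitG) = .straight) (hcol : r.1 = w.1 - 1) (hbelow : r.2 < w.2)
    (hdown : ∃ j < ω.2.arcs.length, (ω.2.fc j).2 < r.2) :
    phaseIndex ω.2.mids = 0 ∨ phaseIndex ω.2.mids = 3 ∨ phaseIndex ω.2.mids = 5 := by
  obtain ⟨a, b, ha, hb, -, hX⟩ := phaseIndex_of_cost_seven_straight_holeColumn_below hh hr h hA hc hz hstr8 hcol hbelow hdown
  rw [hX]
  interval_cases a <;> interval_cases b <;> norm_num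

end ΩG

end Literature.Probability.RandomPlanarGeometry.SAW.YangBaxter
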